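import Literature.NumberTheory.Transcendental.KZFibredRelations
import Literature.NumberTheory.Transcendental.KZDominatedFamily
import Summits.KontsevichZagierPeriods.KontsevichZagierPeriods.Theorems.ValuedFieldSpecialisationParametricLiftingSliceValueElementaryFamily
import Summits.KontsevichZagierPeriods.KontsevichZagierPeriods.Theorems.ValuedFieldSpecialisationParametricLiftingDivergentMonomialsCoeff

/-!
# Route ValuedFieldSpecialisation — crux `ParametricLifting` (stmt-KontsevichZagierPeriods-3498),
line `registered` (reshaped by dimension grading), glue stub W2
`stub_eval_coefficientClass_eq_zero`: COEFFICIENT CLASSES OF A SLICE-NULL ELEMENTARY NET HAVE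
VALUE ZERO

Helper (`--supports`) for item stmt-KontsevichZagierPeriods-3498. If the slices of an elementary
divergent net `D = Σ mᵢ [Pᵢ]` (the `Pᵢ` elementary divergent products of monomial type
`(pᵢ, qᵢ, bᵢ)` over representations `ρᵢ`) vanish on `(0, 1)`, then for every monomial group the
coefficient class has value zero:
`KZ.eval (Σ_{i : pᵢ/qᵢ = p₀/q₀, bᵢ = b₀} mᵢ [ρᵢ]) = 0`.

Proof: by the landed slice formula `stub_sliceValue_elementaryFamily` the slice of `D` at `s` is
`Σ wᵢ s^{aᵢ} (log s)^{bᵢ}` with `aᵢ = −pᵢ/qᵢ`, `wᵢ = mᵢ (−1)^{bᵢ} (ρᵢ).value`; every monomial is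
divergent (`qᵢ > 0` and `pᵢ > 0 ∨ bᵢ > 0`), so the landed grouped-coefficient lemma
`stub_divergentMonomials_coeff_eq_zero` (along `𝓝[>] 0`, limit `0`) kills every grouped
coefficient, and the coefficient of the group of `i₀` is `(−1)^{b₀} · KZ.eval (Σ_group mᵢ [ρᵢ])`.
This is verbatim the computation inside
`coefficientClasses_mem_relations_of_kzKernelConjecture` (file
`ValuedFieldSpecialisationParametricLiftingCoefficientClassesStrength`), minus its appeal to the
kernel conjecture; it is restated here as the unconditional VALUE statement the graded induction
of the reshaped skeleton consumes.

Sources: T. Kaiser, *Lebesgue measure and integration theory on non-archimedean real closed fields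
with archimedean value group*, Proc. LMS 116 (2017), §4, Lemma 4.6 / Prop. 4.7 (dominant-exponent
argument); M. Kontsevich, D. Zagier, *Periods* (2001), §1.1–1.2. Deliberately NOT here: anything
about membership in `KZ.relations` (that is the induction step of the skeleton, not this stub).
-/

noncomputable section

namespace Summit.KontsevichZagierPeriods.ValuedFieldSpecialisation

open MeasureTheory Set Filter
open scoped Topology
open Literature.NumberTheory.Transcendental

/-- **Glue W2 — coefficient classes of a slice-null elementary net have value zero.** If the
slices of `D = Σ mᵢ [Pᵢ]` (elementary divergent products over `ρᵢ`) vanish on `(0,1)`, then for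
every monomial group `KZ.eval (Σ_{i : pᵢ/qᵢ = p₀/q₀, bᵢ = b₀} mᵢ [ρᵢ]) = 0`: by the slice formula
(`stub_sliceValue_elementaryFamily`) the slice of `D` is `Σ wᵢ s^{aᵢ} (log s)^{bᵢ}` with
`aᵢ = −pᵢ/qᵢ`, `wᵢ = mᵢ (−1)^{bᵢ} (ρᵢ).value`, all monomials divergent, so grouped coefficients
vanish (`stub_divergentMonomials_coeff_eq_zero` along `𝓝[>] 0`, limit `0`), and a group's
coefficient is `(−1)^{b₀} · KZ.eval (Σ_group mᵢ [ρᵢ])`. (The computation inside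
`coefficientClasses_mem_relations_of_kzKernelConjecture`, minus its appeal to the kernel
conjecture.) [cite: Kaiser2017, Prop. 4.7] -/
theorem stub_eval_coefficientClass_eq_zero :
    ∀ (k : ℕ) (m : Fin k → ℤ) (p q b d : Fin k → ℕ) (ρ : (i : Fin k) → KZ.IntegralRep (d i)) (P : (i : Fin k) → KZ.IntegralRep (b i + d i + 1 + 1)), (∀ i, 0 < q i ∧ p i < q i ∧ (0 < p i ∨ 0 < b i) ∧ (P i).domain = {z | ∃ (s u : ℝ) (y : Fin (b i) → ℝ) (w : Fin (d i) → ℝ), z = Matrix.vecCons s (Matrix.vecCons u (Fin.append y w)) ∧ 0 < s ∧ s < 1 ∧ 0 < u ∧ u ^ (q i) * s ^ (p i) < 1 ∧ (∀ j, s ≤ y j ∧ y j ≤ 1) ∧ w ∈ (ρ i).domain} ∧ (P i).integrand = fun z => (∏ j : Fin (b i), (z (Fin.castAdd (d i) j).succ.succ)⁻¹) * (ρ i).integrand (fun l : Fin (d i) => z (Fin.natAdd (b i) l).succ.succ)) → (∀ s ∈ Set.Ioo (0 : ℝ) 1, KZ.sliceEval (∑ i, m i • KZ.of (P i)) s = 0)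 → ∀ i₀ : Fin k, KZ.eval (∑ i ∈ Finset.univ.filter (fun i => (p i / q i : ℝ) = (p i₀ / q i₀ : ℝ) ∧ b i = b i₀), m i • KZ.of (ρ i)) = 0 := by
  -- adapted from `coefficientClasses_mem_relations_of_kzKernelConjecture`
  -- (Theorems/ValuedFieldSpecialisationParametricLiftingCoefficientClassesStrength), dropping `apply hK`
  intro k m p q b d ρ P hP hslice i₀
  simp only [map_sum, map_zsmul, KZ.eval_of, zsmul_eq_mul]
  have hcoef := stub_divergentMonomials_coeff_eq_zero k (fun i => -(p i / q i : ℝ)) b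
    (fun i => (m i : ℝ) * (-1) ^ (b i) * (ρ i).value) (𝓝[>] (0 : ℝ)) 0 inferInstance le_rfl ?_ ?_ i₀
  · beta_reduce at hcoef
    have hfilt : (Finset.univ.filter fun i => -(p i / q i : ℝ) = -(p i₀ / q i₀ : ℝ) ∧ b i = b i₀) =
        Finset.univ.filter fun i => (p i / q i : ℝ) = (p i₀ / q i₀ : ℝ) ∧ b i = b i₀ := by
      refine Finset.filter_congr fun i _ => ?_
      rw [neg_inj]
    rw [hfilt] at hcoef
    have hfac : ∑ i ∈ Finset.univ.filter (fun i => (p i / q i : ℝ) = (p i₀ / q i₀ : ℝ) ∧ b i = b i₀),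
        (m i : ℝ) * (-1) ^ (b i) * (ρ i).value =
        (-1) ^ (b i₀) * ∑ i ∈ Finset.univ.filter
          (fun i => (p i / q i : ℝ) = (p i₀ / q i₀ : ℝ) ∧ b i = b i₀), (m i : ℝ) * (ρ i).value := by
      rw [Finset.mul_sum]
      refine Finset.sum_congr rfl fun i hi => ?_
      obtain ⟨-, -, hb⟩ := Finset.mem_filter.mp hi
      rw [hb]; ring
    rw [hfac, mul_eq_zero] at hcoef
    exact hcoef.resolve_left (pow_ne_zero _ (by norm_num))
  · intro i
    obtain ⟨hq, -, hpb, -, -⟩ := hP i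
    rcases Nat.eq_zero_or_pos (p i) with hp | hp
    · right
      exact ⟨by simp [hp], hpb.resolve_left (by omega)⟩
    · left
      have : (0 : ℝ) < p i / q i := div_pos (Nat.cast_pos.mpr hp) (Nat.cast_pos.mpr hq)
      linarith
  · refine (tendsto_const_nhds (x := (0 : ℝ))).congr' ?_
    filter_upwards [(Ioo_mem_nhdsGT one_pos : Ioo (0 : ℝ) 1 ∈ 𝓝[>] (0 : ℝ))] with s hs
    have h0 := hslice s hs
    simp only [map_sum, map_zsmul, KZ.sliceEval_of, Finset.sum_apply, Pi.smul_apply] at h0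
    simp only [zsmul_eq_mul] at h0
    rw [eq_comm, ← h0]
    refine Finset.sum_congr rfl fun i _ => ?_
    obtain ⟨hq, -, -, hdom, hint⟩ := hP i
    rw [stub_sliceValue_elementaryFamily (p i) (q i) (b i) (d i) (ρ i) (P i) hq hdom hint s hs,
      neg_eq_neg_one_mul (Real.log s), mul_pow]
    ring

end Summit.KontsevichZagierPeriods.ValuedFieldSpecialisation
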